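import Literature.NumberTheory.Sieve.BombieriAsymptoticSieveLemma11T
import Literature.NumberTheory.Sieve.BombieriAsymptoticSieveLemma12T
import Literature.NumberTheory.Sieve.BombieriAsymptoticSieveSigma0T
import Literature.NumberTheory.Sieve.BombieriAsymptoticSieveSigma0
import HarnessLib

/-!
# Bombieri's asymptotic sieve: proof of `Literature.NumberTheory.Sieve.bombieri_asymptotic_sieve` (`ParityBarrier.lean`)

Topic `Literature/NumberTheory/Sieve`, companion ("Proofs") file of `ParityBarrier.lean` and
`BombieriAsymptoticSieve.lean`. Everything here is PROVED (theorems only, no new definitions, no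
`sorry`): `bombieri_asymptotic_sieve_holds : bombieri_asymptotic_sieve`.

The named fact `Literature.NumberTheory.Sieve.bombieri_asymptotic_sieve` (`ParityBarrier.lean`) states Bombieri's theorem
([BombieriAsymptoticSieve1976]; [FriedlanderIwaniecPisa1978] Theorem 1): for `k ≥ 2` and a sifted
sequence `𝒜` with `X(x) = x`, density of sieve dimension `1` (`HasSieveDimension g 1 K`) with
`∑_{p ≤ x} g(p) log p = log x + c + O_B((log x)^{−B})` (`HasLinearDensity`), singular-series constant
`H` (`HasDensityConstant`), level of distribution `x^θ` for every `θ < 1` (squarefree moduli) and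
`∑_{n ≤ x} a_n² ≪ x (log x)^C`, one has `∑_{n ≤ x} Λ_k(n) a_n ∼ k H x (log x)^{k−1}`. These
hypotheses are NOT Bombieri's (A₁)–(A₅) (no pointwise bound (A₃), no analytic continuation (A₅),
no information on prime-power or non-squarefree moduli; see the transcription note there and
`Bombieri1976_asymptotic_sieve` in `BombieriAsymptoticSieve.lean` for the statement as printed,
proved in `BombieriAsymptoticSieveTheorem1.lean`), but the printed proof
([FriedlanderIwaniecPisa1978] §4) goes through with the changes recorded in the three lemma files:

* `BombieriSieve.treeLemma10` (`BombieriAsymptoticSieveSigma0T.lean`) — Lemma 10, the `Σ₀`-bound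
  for `z ≤ x^{1/(2(k+10))}`, by grouping according to the radical of the smooth part and sieving
  on squarefree moduli only;
* `BombieriSieve.treeLemma11` (`BombieriAsymptoticSieveLemma11T.lean`) — Lemma 11 (`Σ₂`), the rough
  non-squarefree `n` being negligible by Cauchy–Schwarz;
* `BombieriSieve.treeLemma12` (`BombieriAsymptoticSieveLemma12T.lean`) — Lemma 12 (`Σ₁`), with the
  oscillatory replacement of Lemma 9 (`BombieriAsymptoticSieveOscillation.lean`, fed by
  `HasLinearDensity` through the prime number theorem with logarithmic saving,
  `MertensSecondLogPower.lean`) and `V(z) ∼ H P(z)` from `HasDensityConstant`.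

`BombieriSieve.coreT` combines them at `y = x^{1−2u^{−3}}`, `z = x^{u^{−4}}`, `s = u` exactly as
`BombieriSieve.core` does under (A₁)–(A₅) ([FriedlanderIwaniecPisa1978] pp. 739–740), and
`bombieri_asymptotic_sieve_of_treeLemmata` eliminates the common main term `H x F(x, y, z)`
against the integers, for which Lemmata 10–12 and Lemma 3 are theorems of the tree
(`FI1978_lemma10_holds`, `FI1978_lemma11_holds`, `FI1978_lemma12_holds`, `FI1978_lemma3_rat_holds`).

## References

* E. Bombieri, *The asymptotic sieve*, Rend. Accad. Naz. XL (5) 1/2 (1975/76), 243–269.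
  [BombieriAsymptoticSieve1976]
* J. Friedlander, H. Iwaniec, *On Bombieri's asymptotic sieve*, Ann. Scuola Norm. Sup. Pisa
  Cl. Sci. (4) 5 (1978), 719–756, Theorem 1 and §4. [FriedlanderIwaniecPisa1978]
* E. Bombieri, *The asymptotic sieve* (notes by Y. Motohashi), RIMS Kôkyûroku 294 (1977), 1–8.
  [BombieriRIMS1977]
-/

open Filter Finset Asymptotics
open scoped Topology ArithmeticFunction.Moebius ArithmeticFunction.vonMangoldt

noncomputable section

namespace Literature.NumberTheory.Sieve

namespace BombieriSieve

/-- **The three lemmata combined, tree hypotheses** (the analogue of `BombieriSieve.core` for the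
hypotheses of `Literature.NumberTheory.Sieve.bombieri_asymptotic_sieve`: size `X(x) = x`). With `u → ∞`,
`y = x^{1−2u^{−3}}`, `z = x^{u^{−4}}`, `s = u`: given the `Σ₀`, `Σ₂`, `Σ₁` bounds in the shapes
`h10`, `h11`, `h12` below, for every `ε' > 0`, for all large `u` and then all large `x`,
`|S_k(x) − H x F(x, y, z)| ≤ ε' x (log x)^{k−1}`.
[cite: FriedlanderIwaniecPisa1978, pp. 739-740 (conclusion of proof of Theorem 1)] -/
theorem coreT {A : SieveSequence} {H : ℝ} {k : ℕ} (hk : 2 ≤ k)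
    (h10 : ∃ θ₀ : ℝ, 0 < θ₀ ∧ ∃ C : ℝ, ∀ δ : ℝ, 0 < δ → ∀ᶠ x : ℝ in atTop, ∀ z : ℝ,
      2 ≤ z → z ≤ x ^ θ₀ →
        sigma0 A k x z ≤ C * x * Real.log x ^ (k - 2) * Real.log z + δ * x * Real.log x ^ (k - 1))
    (h11 : ∃ C : ℝ, ∀ ε : ℝ, 0 < ε → ∀ ν : ℝ, 0 < ν → ∀ᶠ x : ℝ in atTop, ∀ y z : ℝ,
      2 ≤ z → x ^ ν ≤ z → z * y < x → z * Real.sqrt x < y → y < x ^ (1 - ε) →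
        |sigma2 A k x y z| ≤ C * x * Real.log (x / y) ^ (k + 1) / Real.log z ^ 2)
    (h12 : ∃ C : ℝ, ∀ ε : ℝ, 0 < ε → ∀ s : ℝ, 2 ≤ s → ∀ ν : ℝ, 0 < ν → ∀ δ : ℝ, 0 < δ →
      ∀ᶠ x : ℝ in atTop, ∀ y z : ℝ, 2 ≤ z → x ^ ν ≤ z → 1 ≤ y → z ^ s * y ≤ x ^ (1 - ε) →
        |sigma1 A k x y z - H * x * mainTermF k x y z| ≤
          C * Real.exp (-s) * x * Real.log x ^ (k - 1) * (Real.log x / Real.log z) ^ 2 +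
            δ * x * Real.log x ^ (k - 1))
    {ε : ℝ} (hε : 0 < ε) :
    ∀ᶠ u : ℝ in atTop, ∀ᶠ x : ℝ in atTop,
      |(∑ n ∈ Ioc 0 ⌊x⌋₊, generalizedVonMangoldt k n * A.a n) -
          H * x * mainTermF k x (x ^ (1 - 2 * u⁻¹ ^ 3)) (x ^ (u⁻¹ ^ 4))| ≤
        ε * x * Real.log x ^ (k - 1) := by
  obtain ⟨m, rfl⟩ : ∃ m, k = m + 2 := ⟨k - 2, by omega⟩
  have e1 : m + 2 - 1 = m + 1 := by omega
  have e2 : m + 2 - 2 = m := by omega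
  obtain ⟨θ₀, hθ₀, C₀, hC₀⟩ := h10
  obtain ⟨C₂, hC₂⟩ := h11
  obtain ⟨C₁, hC₁⟩ := h12
  simp only [e1, e2] at hC₀ hC₁ ⊢
  set D₀ := max C₀ 0 with hD₀
  set D₁ := max C₁ 0 with hD₁
  set D₂ := max C₂ 0 with hD₂
  -- `Ψ(u) → 0`
  have hΨ : Tendsto (fun u : ℝ => (D₀ + 2) * u⁻¹ ^ 4 + D₂ * 2 ^ (m + 3) * u⁻¹ +
      D₁ * (u ^ 8 * Real.exp (-u))) atTop (𝓝 0) := by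
    have h1 : Tendsto (fun u : ℝ => u⁻¹) atTop (𝓝 0) := tendsto_inv_atTop_zero
    have h2 : Tendsto (fun u : ℝ => u⁻¹ ^ 4) atTop (𝓝 0) := by simpa using h1.pow 4
    have h3 := Real.tendsto_pow_mul_exp_neg_atTop_nhds_zero 8
    simpa using ((h2.const_mul (D₀ + 2)).add (h1.const_mul (D₂ * 2 ^ (m + 3)))).add
      (h3.const_mul D₁)
  filter_upwards [(tendsto_order.1 hΨ).2 ε hε, eventually_ge_atTop (2 : ℝ),
    eventually_ge_atTop θ₀⁻¹] with u hu hu2 huθ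
  have hu0 : 0 < u := by linarith
  set v : ℝ := u⁻¹ with hv
  have hv0 : 0 < v := inv_pos.mpr hu0
  have hv1 : v ≤ 1 / 2 := by rw [hv, one_div]; exact (inv_le_inv₀ hu0 two_pos).mpr hu2
  have hvu : v * u = 1 := by rw [hv]; exact inv_mul_cancel₀ hu0.ne'
  have hvθ : v ^ 4 ≤ θ₀ := by
    have hvle : v ≤ θ₀ := by
      rw [hv]; exact (inv_le_comm₀ hu0 hθ₀).mpr huθ
    calc v ^ 4 ≤ v ^ 1 := pow_le_pow_of_le_one hv0.le (by linarith) (by norm_num)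
      _ = v := pow_one v
      _ ≤ θ₀ := hvle
  -- the three lemmata at this `u`
  have h10' := hC₀ (v ^ 4) (by positivity)
  have h11' := hC₂ (v ^ 3) (by positivity) (v ^ 4) (by positivity)
  have h12' := hC₁ (v ^ 3) (by positivity) u hu2 (v ^ 4) (by positivity) (v ^ 4) (by positivity)
  have hz2 : ∀ᶠ x : ℝ in atTop, 2 ≤ x ^ (v ^ 4) :=
    (tendsto_rpow_atTop (by positivity : 0 < v ^ 4)).eventually_ge_atTop 2
  filter_upwards [h10', h11', h12', hz2, eventually_ge_atTop (2 : ℝ)]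
    with x h10x h11x h12x hz2x hx2
  have hx0 : 0 < x := by linarith
  have hx1 : 1 < x := by linarith
  obtain ⟨hz14, hzy, hzsy, hyx, hy1, hzsy'⟩ := params hv0 hv1 hvu hx2
  set L := Real.log x with hL
  set y := x ^ (1 - 2 * v ^ 3) with hy
  set z := x ^ (v ^ 4) with hz
  have hL0 : 0 < L := Real.log_pos hx1
  have hy0 : 0 < y := Real.rpow_pos_of_pos hx0 _
  have hlogz : Real.log z = v ^ 4 * L := Real.log_rpow hx0 _
  have hlogxy : Real.log (x / y) = 2 * v ^ 3 * L := by
    rw [Real.log_div hx0.ne' hy0.ne', hy, Real.log_rpow hx0]; ring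
  have hzθ : z ≤ x ^ θ₀ := Real.rpow_le_rpow_of_exponent_le hx1.le hvθ
  -- Lemma 10: Σ₀ ≤ (D₀ + 1) v⁴ · x L^{m+1}
  have B0 : sigma0 A (m + 2) x z ≤ (D₀ + 1) * v ^ 4 * (x * L ^ (m + 1)) := by
    have h := h10x z hz2x hzθ
    rw [hlogz] at h
    exact sigma0_arith hx0.le hL0.le h
  -- Lemma 11: |Σ₂| ≤ D₂ 2^{m+3} v · x L^{m+1}
  have B2 : |sigma2 A (m + 2) x y z| ≤ D₂ * 2 ^ (m + 3) * v * (x * L ^ (m + 1)) := by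
    have h := h11x y z hz2x le_rfl hzy hzsy hyx
    rw [hlogxy, hlogz] at h
    exact sigma2_arith hx0.le hL0 hv0 (by linarith) h
  -- Lemma 12: |Σ₁ − HxF| ≤ (D₁ u⁸ e^{−u} + v⁴) · x L^{m+1}
  have B1 : |sigma1 A (m + 2) x y z - H * x * mainTermF (m + 2) x y z| ≤
      (D₁ * (u ^ 8 * Real.exp (-u)) + v ^ 4) * (x * L ^ (m + 1)) := by
    have h := h12x y z hz2x le_rfl hy1 hzsy'
    have hratio : L / Real.log z = u ^ 4 := by
      rw [hlogz, div_eq_iff (by positivity)]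
      have : v ^ 4 * u ^ 4 = 1 := by rw [← mul_pow, hvu, one_pow]
      calc L = L * (v ^ 4 * u ^ 4) := by rw [this, mul_one]
        _ = u ^ 4 * (v ^ 4 * L) := by ring
    rw [hratio] at h
    refine h.trans ?_
    have hW : 0 ≤ Real.exp (-u) * x * L ^ (m + 1) * (u ^ 4) ^ 2 := by positivity
    calc C₁ * Real.exp (-u) * x * L ^ (m + 1) * (u ^ 4) ^ 2 + v ^ 4 * x * L ^ (m + 1)
        ≤ D₁ * Real.exp (-u) * x * L ^ (m + 1) * (u ^ 4) ^ 2 + v ^ 4 * x * L ^ (m + 1) := by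
          have : C₁ * Real.exp (-u) * x * L ^ (m + 1) * (u ^ 4) ^ 2 ≤
              D₁ * Real.exp (-u) * x * L ^ (m + 1) * (u ^ 4) ^ 2 := by
            have := mul_le_mul_of_nonneg_right (le_max_left C₁ 0) hW
            calc C₁ * Real.exp (-u) * x * L ^ (m + 1) * (u ^ 4) ^ 2
                = C₁ * (Real.exp (-u) * x * L ^ (m + 1) * (u ^ 4) ^ 2) := by ring
              _ ≤ max C₁ 0 * (Real.exp (-u) * x * L ^ (m + 1) * (u ^ 4) ^ 2) := this
              _ = _ := by rw [hD₁]; ring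
          linarith
      _ = (D₁ * (u ^ 8 * Real.exp (-u)) + v ^ 4) * (x * L ^ (m + 1)) := by ring
  -- combine
  have hsplit := sum_eq_sigma0_add_sigma1_add_sigma2 A (by omega : 0 < m + 2) x y z
  have h0abs : |sigma0 A (m + 2) x z| = sigma0 A (m + 2) x z :=
    abs_of_nonneg (sigma0_nonneg A _ x z)
  have hW0 : 0 ≤ x * L ^ (m + 1) := by positivity
  calc |(∑ n ∈ Ioc 0 ⌊x⌋₊, generalizedVonMangoldt (m + 2) n * A.a n) -
          H * x * mainTermF (m + 2) x y z|
      = |sigma0 A (m + 2) x z + (sigma1 A (m + 2) x y z - H * x * mainTermF (m + 2) x y z) +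
          sigma2 A (m + 2) x y z| := by rw [hsplit]; ring_nf
    _ ≤ |sigma0 A (m + 2) x z| + |sigma1 A (m + 2) x y z - H * x * mainTermF (m + 2) x y z| +
          |sigma2 A (m + 2) x y z| := abs_add_three _ _ _
    _ ≤ (D₀ + 1) * v ^ 4 * (x * L ^ (m + 1)) +
          (D₁ * (u ^ 8 * Real.exp (-u)) + v ^ 4) * (x * L ^ (m + 1)) +
          D₂ * 2 ^ (m + 3) * v * (x * L ^ (m + 1)) := by rw [h0abs]; linarith
    _ = ((D₀ + 2) * v ^ 4 + D₂ * 2 ^ (m + 3) * v + D₁ * (u ^ 8 * Real.exp (-u))) *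
          (x * L ^ (m + 1)) := by ring
    _ ≤ ε * (x * L ^ (m + 1)) := mul_le_mul_of_nonneg_right hu.le hW0
    _ = ε * x * L ^ (m + 1) := by ring

end BombieriSieve

/-- **Assembly of `bombieri_asymptotic_sieve` from the three lemmata under the tree hypotheses.**
The comparison sequence is the sequence of all integers, for which the three lemmata
(in Bombieri's axiomatisation) and Lemma 3 are theorems of the tree
(`FI1978_lemma10_holds`, `FI1978_lemma11_holds`, `FI1978_lemma12_holds`,
`FI1978_lemma3_rat_holds`): exactly as on [FriedlanderIwaniecPisa1978] p. 740, the common main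
term `F` is eliminated between `𝒜` and the integers (`BombieriSieve.comparison_arith`); `H > 0` by
`BombieriSieve.densityConstant_pos`.
[cite: FriedlanderIwaniecPisa1978, p. 740 (conclusion of proof of Theorem 1)] -/
theorem bombieri_asymptotic_sieve_of_treeLemmata
    (h10 : ∀ (k : ℕ) (_ : 2 ≤ k) (A : SieveSequence) (H c : ℝ) (_ : ∀ x, A.size x = x)
      (_ : ∃ K : ℝ, HasSieveDimension A.density 1 K) (_ : A.HasLinearDensity c)
      (_ : A.HasDensityConstant H) (_ : ∀ θ : ℝ, θ < 1 → HasLevelOfDistribution A θ)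
      (_ : ∃ C : ℝ, (fun x : ℝ => ∑ n ∈ Ioc 0 ⌊x⌋₊, A.a n ^ 2) =O[atTop]
        fun x : ℝ => x * Real.log x ^ C),
      ∃ θ₀ : ℝ, 0 < θ₀ ∧ ∃ C : ℝ, ∀ δ : ℝ, 0 < δ → ∀ᶠ x : ℝ in atTop, ∀ z : ℝ,
        2 ≤ z → z ≤ x ^ θ₀ →
          BombieriSieve.sigma0 A k x z ≤
            C * x * Real.log x ^ (k - 2) * Real.log z + δ * x * Real.log x ^ (k - 1))
    (h11 : ∀ (k : ℕ) (_ : 2 ≤ k) (A : SieveSequence) (H c : ℝ) (_ : ∀ x, A.size x = x)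
      (_ : ∃ K : ℝ, HasSieveDimension A.density 1 K) (_ : A.HasLinearDensity c)
      (_ : A.HasDensityConstant H) (_ : ∀ θ : ℝ, θ < 1 → HasLevelOfDistribution A θ)
      (_ : ∃ C : ℝ, (fun x : ℝ => ∑ n ∈ Ioc 0 ⌊x⌋₊, A.a n ^ 2) =O[atTop]
        fun x : ℝ => x * Real.log x ^ C),
      ∃ C : ℝ, ∀ ε : ℝ, 0 < ε → ∀ ν : ℝ, 0 < ν → ∀ᶠ x : ℝ in atTop, ∀ y z : ℝ,
        2 ≤ z → x ^ ν ≤ z → z * y < x → z * Real.sqrt x < y → y < x ^ (1 - ε) →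
          |BombieriSieve.sigma2 A k x y z| ≤ C * x * Real.log (x / y) ^ (k + 1) / Real.log z ^ 2)
    (h12 : ∀ (k : ℕ) (_ : 2 ≤ k) (A : SieveSequence) (H c : ℝ) (_ : ∀ x, A.size x = x)
      (_ : ∃ K : ℝ, HasSieveDimension A.density 1 K) (_ : A.HasLinearDensity c)
      (_ : A.HasDensityConstant H) (_ : ∀ θ : ℝ, θ < 1 → HasLevelOfDistribution A θ)
      (_ : ∃ C : ℝ, (fun x : ℝ => ∑ n ∈ Ioc 0 ⌊x⌋₊, A.a n ^ 2) =O[atTop]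
        fun x : ℝ => x * Real.log x ^ C),
      ∃ C : ℝ, ∀ ε : ℝ, 0 < ε → ∀ s : ℝ, 2 ≤ s → ∀ ν : ℝ, 0 < ν → ∀ δ : ℝ, 0 < δ →
        ∀ᶠ x : ℝ in atTop, ∀ y z : ℝ, 2 ≤ z → x ^ ν ≤ z → 1 ≤ y → z ^ s * y ≤ x ^ (1 - ε) →
          |BombieriSieve.sigma1 A k x y z - H * x * BombieriSieve.mainTermF k x y z| ≤
            C * Real.exp (-s) * x * Real.log x ^ (k - 1) * (Real.log x / Real.log z) ^ 2 +
              δ * x * Real.log x ^ (k - 1)) :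
    bombieri_asymptotic_sieve := by
  intro k hk A H cl hsize hdim hlin hH hlevel hcrude
  obtain ⟨m, rfl⟩ : ∃ m, k = m + 2 := ⟨k - 2, by omega⟩
  have e1 : m + 2 - 1 = m + 1 := by omega
  have e2 : m + 2 - 2 = m := by omega
  obtain ⟨K, hK⟩ := hdim
  have hH0 : 0 < H := (BombieriSieve.densityConstant_pos A hK hH).2
  obtain ⟨c₃, hc₃, h3'⟩ := FI1978_lemma3_rat_holds
  have hc₃0 : 0 < c₃ := by linarith
  rw [Asymptotics.IsEquivalent, Asymptotics.isLittleO_iff]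
  intro c hc
  simp only [e1]
  set κ : ℝ := ((m + 2 : ℕ) : ℝ) with hκ
  have hκ0 : 0 < κ := by rw [hκ]; positivity
  -- the two applications of `core` at a common `u`
  have hcoreA := BombieriSieve.coreT (A := A) (H := H) hk
    (h10 (m + 2) hk A H cl hsize ⟨K, hK⟩ hlin hH hlevel hcrude)
    (h11 (m + 2) hk A H cl hsize ⟨K, hK⟩ hlin hH hlevel hcrude)
    (h12 (m + 2) hk A H cl hsize ⟨K, hK⟩ hlin hH hlevel hcrude)
    (ε := c * κ * H / 2) (by positivity)
  have hcore1 := BombieriSieve.core FI1978_lemma10_holds FI1978_lemma11_holds FI1978_lemma12_holds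
    SieveSequence.integers_isBombieriSequence SieveSequence.hasDensityConstant_integers hk
    (ε := c * κ / 4) (by positivity)
  obtain ⟨u, huA, hu1⟩ := (hcoreA.and hcore1).exists
  simp only [e1] at huA hu1
  set ε₃ : ℝ := c * κ / 12 with hε₃
  have hε₃0 : 0 < ε₃ := by positivity
  filter_upwards [huA, hu1, eventually_ge_atTop c₃, eventually_ge_atTop (3 : ℝ),
    Real.tendsto_log_atTop.eventually_ge_atTop (c₃ ^ (m + 2) * 2 ^ m / ε₃),
    eventually_ge_atTop (2 * κ / ε₃)] with x hxA hx1 hxc₃ hx3 hxL hxfl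
  have hx2 : 2 ≤ x := by linarith
  have hx0 : 0 < x := by linarith
  have hxone : 1 < x := by linarith
  set L := Real.log x with hL
  set N : ℝ := (⌊x⌋₊ : ℝ) with hN
  set F := BombieriSieve.mainTermF (m + 2) x (x ^ (1 - 2 * u⁻¹ ^ 3)) (x ^ (u⁻¹ ^ 4)) with hF
  have hL1 : 1 ≤ L :=
    LFunctions.MertensBound.one_lt_log_three.le.trans (Real.log_le_log (by norm_num) hx3)
  have hL0 : 0 < L := by linarith
  have hNx : x / 2 ≤ N := BombieriSieve.half_le_floor hx2
  have hN0 : 0 < N := by linarith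
  have hNle : N ≤ x := Nat.floor_le hx0.le
  have hxN1 : x - N ≤ 1 := by have := Nat.lt_floor_add_one x; rw [hN]; linarith
  have hx2N : x ≤ 2 * N := by linarith
  have hκN : κ ≤ ε₃ * N := by
    rw [div_le_iff₀ hε₃0] at hxfl
    calc κ = (2 * κ) / 2 := by ring
      _ ≤ x * ε₃ / 2 := by gcongr
      _ = ε₃ * (x / 2) := by ring
      _ ≤ ε₃ * N := mul_le_mul_of_nonneg_left hNx hε₃0.le
  -- the integers: `S_𝟙(x) = ∑ Λ_k(n)` and `|S_𝟙 − N F| ≤ (cκ/4) N L^{m+1}`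
  have hsum1 : ∑ n ∈ Ioc 0 ⌊x⌋₊, generalizedVonMangoldt (m + 2) n * SieveSequence.integers.a n =
      ∑ n ∈ Ioc 0 ⌊x⌋₊, generalizedVonMangoldt (m + 2) n :=
    Finset.sum_congr rfl fun n _ => by rw [SieveSequence.integers_a, mul_one]
  rw [hsum1, SieveSequence.integers_size, one_mul] at hx1
  -- Lemma 3
  have h3x := h3' (m + 2) hk x hxone.le
  simp only [e1, e2] at h3x
  have hE : c₃ ^ (m + 2) * x * Real.log (c₃ * x) ^ m ≤ ε₃ * x * L ^ (m + 1) := by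
    have hlogcx : Real.log (c₃ * x) ≤ 2 * L := by
      rw [Real.log_mul hc₃0.ne' hx0.ne']
      linarith [Real.log_le_log hc₃0 hxc₃]
    have hlogcx0 : 0 ≤ Real.log (c₃ * x) := Real.log_nonneg (by nlinarith)
    calc c₃ ^ (m + 2) * x * Real.log (c₃ * x) ^ m ≤ c₃ ^ (m + 2) * x * (2 * L) ^ m := by gcongr
      _ = (c₃ ^ (m + 2) * 2 ^ m) * x * L ^ m := by ring
      _ ≤ (ε₃ * L) * x * L ^ m := by
          have hle : c₃ ^ (m + 2) * 2 ^ m ≤ ε₃ * L := by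
            rw [div_le_iff₀ hε₃0] at hxL; linarith
          gcongr
      _ = ε₃ * x * L ^ (m + 1) := by ring
  have h3xx : |(∑ n ∈ Ioc 0 ⌊x⌋₊, generalizedVonMangoldt (m + 2) n) - κ * x * L ^ (m + 1)| ≤
      c * κ / 12 * x * L ^ (m + 1) := h3x.trans hE
  -- conclusion
  have hM0 : 0 ≤ κ * H * x * L ^ (m + 1) := by positivity
  rw [Pi.sub_apply, Real.norm_eq_abs, Real.norm_eq_abs, abs_of_nonneg hM0]
  exact BombieriSieve.comparison_arith hH0 hx0.le hN0 (by positivity) hκ0.le hc.le hNle hxN1 hx2N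
    hκN hxA hx1 h3xx

/-- **Bombieri's asymptotic sieve, as stated in `ParityBarrier.lean`** (**parity.S32** (ii)): for
`k ≥ 2` and a sifted sequence with `X(x) = x`, density of sieve dimension `1` with
`∑_{p≤x} g(p) log p = log x + c + O((log x)^{−B})`, singular-series constant `H`, level of
distribution `x^θ` for every `θ < 1` and `∑_{n≤x} a_n² ≪ x(log x)^C`,
`∑_{n ≤ x} Λ_k(n) a_n ∼ k H x (log x)^{k−1}`. Proof: `bombieri_asymptotic_sieve_of_treeLemmata` with
`BombieriSieve.treeLemma10`, `BombieriSieve.treeLemma11`, `BombieriSieve.treeLemma12`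
([FriedlanderIwaniecPisa1978] §4, proof of Theorem 1 (Bombieri), adapted to these hypotheses as
described in the lemma files). [cite: BombieriAsymptoticSieve1976, main theorem]
[cite: FriedlanderIwaniecPisa1978, Theorem 1] -/
theorem bombieri_asymptotic_sieve_holds : bombieri_asymptotic_sieve :=
  bombieri_asymptotic_sieve_of_treeLemmata
    (fun k hk A H c hsize hdim hlin hH hlevel _ =>
      BombieriSieve.treeLemma10 k hk A H c hsize hdim hlin hH hlevel)
    (fun k _ A H _ hsize hdim _ hH hlevel hcrude =>
      BombieriSieve.treeLemma11 k A H hsize hdim hH hlevel hcrude)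
    (fun k hk A H c hsize hdim hlin hH hlevel hcrude =>
      BombieriSieve.treeLemma12 k hk A H c hsize hdim hlin hH hlevel hcrude)

end Literature.NumberTheory.Sieve
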